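import Mathlib
import Literature.Analysis.FluidPDE.SuitableWeak
import Literature.Analysis.FluidPDE.SelfSimilar
import Literature.Analysis.FluidPDE.LocalTypeI

/-!
# Sketch — first lemmas of three crux ideas for `RellichScar.ApexLocalisation` (stmt-NavierStokesRegularity-11719)

Planner sketch (crux-ideate round 1, ideator 3). Statements only (`def … : Prop`), over existing
Literature declarations; nothing is asserted. Namespace as for crux lines.
-/

noncomputable section

open MeasureTheory Set Filter Topology Metric
open scoped ENNReal NNReal

namespace Summit.NavierStokesRegularity.NavierStokesRegularity.Cruxes.ApexLocalisation.Sketch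

open Literature.Analysis.FluidPDE

/-- Physical space. -/
local notation "E3" => EuclideanSpace ℝ (Fin 3)

/-- The rate-Type-I local-energy class of the crux, with an explicit bound `M` on the
Albritton–Barker quantity `𝐈(ℝ³×ℝ₋)`: suitable weak solution of unforced unit-viscosity
Navier–Stokes on the slab `(−∞,0) × ℝ³`, weak spatial gradient `G`, `𝐈 ≤ M`, and the temporal
Type-I rate `‖u(t,x)‖ ≤ C/√(−t)` (`HasTypeITimeDecay`). -/
def InRateClass (M : ℝ≥0) (C : ℝ) (u : ℝ → E3 → E3) (p : ℝ → E3 → ℝ)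
    (G : ℝ → E3 → E3 →L[ℝ] E3) : Prop :=
  IsSuitableWeakSolutionOn (slab E3 (Iio 0) isOpen_Iio) 1 0 u p ∧
    HasWeakSpatialGradientOn (slab E3 (Iio 0) isOpen_Iio) u G ∧
    typeIBound (Iio (0 : ℝ) ×ˢ univ) u p G ≤ (M : ℝ≥0∞) ∧ HasTypeITimeDecay C u

/-- **Card 1, first lemma (ConfinementImpliesApex).** "Apex = Type-I-small outside a paraboloid":
for every bound `M` on `𝐈` and rate constant `C` there is a threshold `η = η(M) > 0` such that,
for every aperture `R > 0`, some constant `C' = C'(M, C, R)` works uniformly: if a flow of the rate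
class has rate usage `√(−t)‖u(t,x)‖ ≤ η` at every point OUTSIDE the paraboloid `‖x‖ ≥ R√(−t)`
(i.e. its `η`-active set is confined to the paraboloid), then it obeys the space–time Type-I bound
`‖u‖ ≤ C'/(‖x‖ + √(−t))` almost everywhere on the slab (KNSS (1.6), `HasTypeIDecay` up to a
representative). Engine: localized smoothing (Barker–Prange 2020 Thm 1, tree
`BarkerPrange2020_thm1_slab`; Jia–Šverák 2014 Thm 3.1) on flat cylinders outside the paraboloid —
rate-smallness at ONE time slice plus the Morrey bound `A ≤ 𝐈 ≤ M` gives boundedness afterwards;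
CKN ε-regularity alone does not (the scaled `L³` of `η/√(−t)` diverges at the final time). -/
def ConfinementImpliesApex : Prop :=
  ∀ (M : ℝ≥0) (C : ℝ), ∃ η : ℝ, 0 < η ∧ ∀ R : ℝ, 0 < R → ∃ C' : ℝ,
    ∀ (u : ℝ → E3 → E3) (p : ℝ → E3 → ℝ) (G : ℝ → E3 → E3 →L[ℝ] E3),
      InRateClass M C u p G →
      (∀ t : ℝ, t < 0 → ∀ x : E3, R * Real.sqrt (-t) ≤ ‖x‖ → Real.sqrt (-t) * ‖u t x‖ ≤ η) →
      ∀ᵐ z : ℝ × E3 ∂(volume.restrict (Iio (0 : ℝ) ×ˢ univ)),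
        ‖u z.1 z.2‖ ≤ C' / (‖z.2‖ + Real.sqrt (-z.1))

/-- The final-time singular set of a flow on the slab: the points `x` such that the space–time
point `(0, x)` is a backward singular point (Albritton–Barker; tree `IsBackwardSingularPoint`). -/
def finalSingularSet (u : ℝ → E3 → E3) : Set E3 :=
  {x | IsBackwardSingularPoint u ((0 : ℝ), x)}

/-- **Card 2, first lemma (FinalSliceRadialNull).** For a flow of the rate class the final-time
singular set `S` is closed, `ℋ¹(S) = 0` (CKN partial regularity run with BACKWARD cylinders at the
top of the slab: Lin / Ladyzhenskaya–Seregin ε-regularity, tree `lemarieRieusset_epsilon_regularity`,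
`ckn_partial_regularity_holds` for the interior), hence — the radial map being 1-Lipschitz and
proper on `S` — the set of radii `{‖x − x₀‖ : x ∈ S}` is a closed Lebesgue-null subset of `ℝ` for
every centre `x₀`: spheres about any point miss `S` at almost every radius, in whole open
intervals of radii. (Set-level input of the onion construction.) -/
def FinalSliceRadialNull : Prop :=
  ∀ (M : ℝ≥0) (C : ℝ) (u : ℝ → E3 → E3) (p : ℝ → E3 → ℝ) (G : ℝ → E3 → E3 →L[ℝ] E3),
    InRateClass M C u p G →
      IsClosed (finalSingularSet u) ∧ μH[1] (finalSingularSet u) = 0 ∧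
        ∀ x₀ : E3, IsClosed ((fun x : E3 => ‖x - x₀‖) '' finalSingularSet u) ∧
          volume ((fun x : E3 => ‖x - x₀‖) '' finalSingularSet u) = 0

/-- **Card 3, first lemma (NoFinalTimeConcentration).** A flow of the rate class loses no local
kinetic energy into its final-time singular set: there is a scar `σ ∈ L²_loc(ℝ³)` (indeed Morrey:
`∫_{B_r(x)}|σ|² ≤ M r`) with `u(t) → σ` strongly in `L²_loc` as `t ↑ 0`, stated
representative-free as the vanishing of the time-averaged `L²` distance
`δ⁻¹ ∫_{−δ}^{0} ‖u(t) − σ‖²_{L²(B_r)} dt → 0`. Engine: any weak-* limit of `|u(t_k)|² dx` is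
`|σ|² dx + θ` with `θ ≥ 0` supported on `S`, `θ(B_ρ(x)) ≤ 2Mρ` for all balls (the `A`-part of
`𝐈 ≤ M`), so `θ ≪ ℋ¹⌊S = 0` (upper-density theorem; `FinalSliceRadialNull`). Consequence used by
the card: `u` glues to a forward local-Leray solution from `σ` into a suitable weak solution on
`ℝ³ × (−∞, T₊)` for which `(0,0)` is an INTERIOR singular point. -/
def NoFinalTimeConcentration : Prop :=
  ∀ (M : ℝ≥0) (C : ℝ) (u : ℝ → E3 → E3) (p : ℝ → E3 → ℝ) (G : ℝ → E3 → E3 →L[ℝ] E3),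
    InRateClass M C u p G →
      ∃ σ : E3 → E3,
        (∀ (x₀ : E3) (r : ℝ), 0 < r →
          ∫⁻ x in ball x₀ r, ‖σ x‖ₑ ^ 2 ≤ ENNReal.ofReal ((M : ℝ) * r)) ∧
        ∀ r : ℝ, 0 < r →
          Tendsto (fun δ : ℝ => (ENNReal.ofReal δ)⁻¹ *
              ∫⁻ z in Ioo (-δ) 0 ×ˢ ball (0 : E3) r, ‖u z.1 z.2 - σ z.2‖ₑ ^ 2)
            (𝓝[>] (0 : ℝ)) (𝓝 0)

/-- Sanity link with the crux: an a.e. space–time Type-I bound is what `ConfinementImpliesApex`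
delivers; the crux's `HasTypeIDecay C' u'` is then obtained for the regularised representative
`u'` (bounded suitable weak solutions are smooth for `t < 0`). Recorded as the target shape only. -/
def AEApexBound (C' : ℝ) (u : ℝ → E3 → E3) : Prop :=
  ∀ᵐ z : ℝ × E3 ∂(volume.restrict (Iio (0 : ℝ) ×ˢ univ)), ‖u z.1 z.2‖ ≤ C' / (‖z.2‖ + Real.sqrt (-z.1))

/-- Trivial direction, for orientation: a genuine (pointwise) apex bound is an a.e. apex bound. -/
theorem aeApexBound_of_hasTypeIDecay {C' : ℝ} {u : ℝ → E3 → E3} (h : HasTypeIDecay C' u) :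
    AEApexBound C' u := by
  refine (ae_restrict_iff' (measurableSet_Iio.prod MeasurableSet.univ)).2 (Filter.Eventually.of_forall ?_)
  rintro ⟨t, x⟩ ⟨ht, -⟩
  exact h t ht x

end Summit.NavierStokesRegularity.NavierStokesRegularity.Cruxes.ApexLocalisation.Sketch

end
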